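import Summits.Ventures.WeilGRH.TwistedGramCellCheckOdd
import HarnessLib

/-!
# GRH arm (rh-explicit, venture WeilGRH): twisted format C — the SMALL-CELL checker, ODD sector, far-diagonal SIGN facts
  (brick (E3a-odd) of the χ instance lane: `h0o`, `hd0o`, `hwo` of the door from interval boxes)

Cell `rh-explicit`, WEIL TRACK — GRH ARM (engine seat weil-grh-2 gen7).  Sequel of `TwistedGramCellCheckOdd.lean`: boxes of
the CRUDE odd far diagonal (`(π/2 − arctan √(B/(l+1)))/2` replaced by its bound `π/4`; `√(8/B)` by a checked rational `r₈`;
both only lower the diagonal — the real finite remainder still closes with blocks ≤ 64 × 512, FORMATC-CHI-LANE.md), the integer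
comparisons `checkSignsO`, and ★ `signsO_of_checkSignsO` delivering `h0o`, `hd0o`, `hwo` LITERALLY in the shape of
`weilPositivityOnChar_of_twisted_formatC_data`, given boxes `CC ∋ a(1+E(2a))`, `AOP ∋ A_op⁺(a)`.  Everything is PROVED;
computable `def`s; no named facts; RH/GRH-free.  References: H. Yoshida (1992) §7 [Yoshida1992HermitianForms]; R. E. Moore (1966) [Moore1966].
-/

set_option autoImplicit false

open Real Complex Finset
open scoped BigOperators ArithmeticFunction.vonMangoldt

namespace Summit.Ventures.WeilGRH

open Literature.NumberTheory.LFunctions Literature.NumberTheory.LFunctions.Yoshida1992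
open Literature.NumberTheory.LFunctions.Yoshida1992.Encl
open Literature.Analysis.SpecialFunctions Literature.Analysis.ValidatedNumerics.NumericsMP

namespace TwistedEncl

variable {S : ℕ} {a : ℝ} {q : ℕ}

/-! ## The odd far-diagonal sign facts (crude column penalty `π/4`) -/

/-- Box of the crude odd far diagonal `d̂′⁻(l) = (Re ψ(¼+iω_{l+1}/2) − log π + log q)/2 − 1/(8(l+1)) − C/(π²(l+1)²) − π/4 −
(C/π²)·r₈ − A_op⁺/2` (`r₈ ≥ √(8/B)`; `π/4 ≥ (π/2 − arctan √(B/(l+1)))/2`, so `d̂′⁻ ≤ d̂⁻` of the door, and `d̂′⁻` IS the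
door's bound at `l = B` and in `hd0o`). [cite: Yoshida1992HermitianForms, §7 pp. 305–312] -/
def dhatOBox (S : ℕ) (C : Consts) (LQ : MI) (tab : List IdxRec) (d : OddCellData) (l : ℕ) : MI :=
  let cpi := (d.CC.mul S C.invPi).mul S C.invPi
  ((((((((tget tab (l + 1)).reP.sub C.logPi).add LQ).divNat 2).sub (MI.ofFrac S 1 (8 * (l + 1)))).sub
    (cpi.divNat ((l + 1) * (l + 1)))).sub (C.P.divNat 4)).sub ((cpi.mulInt d.r8N).divNat d.r8D)).sub (d.AOP.divNat 2)

/-- The real crude odd far diagonal. [cite: Yoshida1992HermitianForms, §7 pp. 305–312] -/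
noncomputable def dhatOLow (a Lq Cc Aop r8 : ℝ) (l : ℕ) : ℝ :=
  (reDigammaQuarter (freq a ((l : ℤ) + 1)) - Real.log π + Lq) / 2 - 1 / (8 * ((l : ℝ) + 1)) -
    Cc / π ^ 2 / (((l : ℝ) + 1) * ((l : ℝ) + 1)) - π / 4 - Cc / π ^ 2 * r8 - Aop / 2

/-- Soundness of `dhatOBox` (`l + 1 < N`). [cite: Moore1966, Ch. 3 (interval arithmetic: inclusion property)] -/
theorem mem_dhatOBox (hS : 0 < S) {ks : List PrimeLen} {C : Consts} (hC : ConstsValid S a ks C) {LQ : MI} {Lq : ℝ}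
    (hLQ : MI.mem S Lq LQ) {N : ℕ} {tab : List IdxRec} (hT : TabValid S a ks N tab) {d : OddCellData} {Cc Aop : ℝ}
    (hCC : MI.mem S Cc d.CC) (hAOP : MI.mem S Aop d.AOP) (hr8D : 0 < d.r8D) {l : ℕ} (hl : l + 1 < N) :
    MI.mem S (dhatOLow a Lq Cc Aop ((d.r8N : ℝ) / d.r8D) l) (dhatOBox S C LQ tab d l) := by
  unfold dhatOBox dhatOLow
  have hcpi : MI.mem S (Cc / π ^ 2) ((d.CC.mul S C.invPi).mul S C.invPi) := by
    refine mem_of_eq (MI.mem_mul hS (MI.mem_mul hS hCC hC.invPi) hC.invPi) ?_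
    field_simp
  have hreP := (hT (l + 1) hl).2.reP
  push_cast at hreP
  have h := MI.mem_sub (MI.mem_sub (MI.mem_sub (MI.mem_sub (MI.mem_sub (MI.mem_divNat (MI.mem_add (MI.mem_sub hreP
    hC.logPi) hLQ) (n := 2) (by norm_num)) (MI.mem_ofFrac S 1 (q := 8 * (l + 1)) (by omega)))
    (MI.mem_divNat hcpi (n := (l + 1) * (l + 1)) (by positivity))) (MI.mem_divNat hC.pi (n := 4) (by norm_num)))
    (MI.mem_divNat (MI.mem_mulInt hcpi d.r8N) hr8D)) (MI.mem_divNat hAOP (n := 2) (by norm_num))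
  refine mem_of_eq h ?_
  push_cast
  ring

/-- The odd sign checks: `r₈² ≥ 8/B`, `d̂′⁻(B) > 0`, `d₀ ≤ d̂′⁻(B₃)`, `w_{B+c} ≤ d̂′⁻(B+c)`. [cite: Moore1966, Ch. 3 (interval arithmetic: inclusion property)] -/
def checkSignsO (S : ℕ) (C : Consts) (LQ : MI) (tab : List IdxRec) (d : OddCellData) : Bool :=
  decide (1 ≤ d.B) && decide (2 * d.B ≤ d.B3) && decide (0 < d.r8D) && decide (0 < d.d0N) &&
    decide (8 * d.r8D ^ 2 ≤ d.B * d.r8N ^ 2) &&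
    decide (0 < (dhatOBox S C LQ tab d d.B).lo) &&
    decide ((d.d0N : ℤ) * S ≤ (dhatOBox S C LQ tab d d.B3).lo * 2 ^ d.wbits) &&
    (List.range (d.B3 - d.B)).all fun c ↦ decide (0 < d.wN.getD c 0) &&
      decide ((d.wN.getD c 0 : ℤ) * S ≤ (dhatOBox S C LQ tab d (d.B + c)).lo * 2 ^ d.wbits)

/-- ★ **The door's odd-sector sign facts from checked boxes** (`h0o`, `hd0o`, `hwo` of
`weilPositivityOnChar_of_twisted_formatC_data` with `d0o = d0N·2^{−wbits}`, `wo l = wN_{l−B}·2^{−wbits}`).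
[cite: Yoshida1992HermitianForms, §7 pp. 305–312] -/
theorem signsO_of_checkSignsO (hS : 0 < S) (ha0 : 0 < a) {ks : List PrimeLen} {C : Consts}
    (hC : ConstsValid S a ks C) {LQ : MI} (hLQ : MI.mem S (Real.log q) LQ) {N : ℕ} {tab : List IdxRec}
    (hT : TabValid S a ks N tab) {d : OddCellData} (hN : d.B3 + 1 < N)
    (hCC : MI.mem S (a * (1 + weilArchDensity (2 * a))) d.CC)
    (hAOP : MI.mem S (∑ k ∈ weilPrimeIndex a, (Λ k : ℝ) / Real.sqrt k * (2 * Real.cos (π / (⌊2 * a / Real.log k⌋₊ + 2)))) d.AOP)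
    (h : checkSignsO S C LQ tab d = true) :
    (0 < ((reDigammaQuarter (freq a ((d.B : ℤ) + 1)) - Real.log π + Real.log q) / 2 - 1 / (8 * ((d.B : ℝ) + 1)) - a * (1 + weilArchDensity (2 * a)) / (π ^ 2 * ((d.B : ℝ) + 1) ^ 2)) - π / 4 - a * (1 + weilArchDensity (2 * a)) / π ^ 2 * Real.sqrt (8 / d.B) - (∑ k ∈ weilPrimeIndex a, (Λ k : ℝ) / Real.sqrt k * (2 * Real.cos (π / (⌊2 * a / Real.log k⌋₊ + 2)))) / 2) ∧
    (0 < (d.d0N : ℝ) / 2 ^ d.wbits ∧ (d.d0N : ℝ) / 2 ^ d.wbits ≤ ((reDigammaQuarter (freq a ((d.B3 : ℤ) + 1)) - Real.log π + Real.log q) / 2 - 1 / (8 * ((d.B3 : ℝ) + 1)) - a * (1 + weilArchDensity (2 * a)) / (π ^ 2 * ((d.B3 : ℝ) + 1) ^ 2)) - π / 4 - a * (1 + weilArchDensity (2 * a)) / π ^ 2 * Real.sqrt (8 / d.B) - (∑ k ∈ weilPrimeIndex a, (Λ k : ℝ) / Real.sqrt k * (2 * Real.cos (π / (⌊2 * a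 / Real.log k⌋₊ + 2)))) / 2) ∧
    (∀ l, d.B ≤ l → l < d.B3 → 0 < (d.wN.getD (l - d.B) 0 : ℝ) / 2 ^ d.wbits ∧ (d.wN.getD (l - d.B) 0 : ℝ) / 2 ^ d.wbits ≤ ((reDigammaQuarter (freq a ((l : ℤ) + 1)) - Real.log π + Real.log q) / 2 - 1 / (8 * ((l : ℝ) + 1)) - a * (1 + weilArchDensity (2 * a)) / (π ^ 2 * ((l : ℝ) + 1) ^ 2) - (π / 2 - Real.arctan (Real.sqrt d.B / Real.sqrt ((l : ℝ) + 1))) / 2 - a * (1 + weilArchDensity (2 * a)) / π ^ 2 * Real.sqrt (8 / d.B) - (∑ k ∈ weilPrimeIndex a, (Λ k : ℝ) / Real.sqrt k * (2 * Real.cos (π / (⌊2 * a / Real.log k⌋₊ + 2)))) / 2)) := by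
  unfold checkSignsO at h
  simp only [Bool.and_eq_true, decide_eq_true_eq, List.all_eq_true, List.mem_range] at h
  obtain ⟨⟨⟨⟨⟨⟨⟨hB1, hBB3⟩, hr8D⟩, hd0N⟩, hr8⟩, h0⟩, hd0⟩, hw⟩ := h
  set Cc := a * (1 + weilArchDensity (2 * a)) with hCc
  set Aop := ∑ k ∈ weilPrimeIndex a, (Λ k : ℝ) / Real.sqrt k * (2 * Real.cos (π / (⌊2 * a / Real.log k⌋₊ + 2))) with hAop
  have hCc0 : 0 ≤ Cc := by
    have hE : 0 < weilArchDensity (2 * a) := weilArchDensity_pos (by positivity)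
    positivity
  have hπ2 : 0 < π ^ 2 := by positivity
  have hr8' : Real.sqrt (8 / (d.B : ℝ)) ≤ (d.r8N : ℝ) / d.r8D := by
    have hB0 : (0 : ℝ) < d.B := by exact_mod_cast (show 0 < d.B by omega)
    have hrD : (0 : ℝ) < d.r8D := by exact_mod_cast hr8D
    have hq : (8 : ℝ) / (d.B : ℝ) ≤ ((d.r8N : ℝ) / d.r8D) ^ 2 := by
      have h' : (8 : ℝ) * (d.r8D : ℝ) ^ 2 ≤ (d.B : ℝ) * (d.r8N : ℝ) ^ 2 := by exact_mod_cast hr8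
      rw [div_pow, div_le_div_iff₀ hB0 (by positivity)]
      linarith
    calc Real.sqrt (8 / (d.B : ℝ)) ≤ Real.sqrt (((d.r8N : ℝ) / d.r8D) ^ 2) := Real.sqrt_le_sqrt hq
      _ = (d.r8N : ℝ) / d.r8D := Real.sqrt_sq (by positivity)
  have hSr : (0 : ℝ) < S := by exact_mod_cast hS
  have step : ∀ l, l + 1 < N → ∀ pen : ℝ, pen ≤ π / 4 →
      ((dhatOBox S C LQ tab d l).lo : ℝ) ≤ S * ((reDigammaQuarter (freq a ((l : ℤ) + 1)) - Real.log π + Real.log q) / 2 -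
        1 / (8 * ((l : ℝ) + 1)) - Cc / (π ^ 2 * ((l : ℝ) + 1) ^ 2) - pen - Cc / π ^ 2 * Real.sqrt (8 / d.B) - Aop / 2) := by
    intro l hl pen hpen
    have hmem := (mem_dhatOBox hS hC hLQ hT hCC hAOP hr8D hl).1
    unfold dhatOLow at hmem
    have h1 : Cc / π ^ 2 * Real.sqrt (8 / (d.B : ℝ)) ≤ Cc / π ^ 2 * ((d.r8N : ℝ) / d.r8D) :=
      mul_le_mul_of_nonneg_left hr8' (div_nonneg hCc0 hπ2.le)
    have h2 : Cc / π ^ 2 / (((l : ℝ) + 1) * ((l : ℝ) + 1)) = Cc / (π ^ 2 * ((l : ℝ) + 1) ^ 2) := by rw [div_div]; ring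
    rw [h2] at hmem
    nlinarith
  have hpen4 : π / 4 ≤ π / 4 := le_rfl
  refine ⟨?_, ⟨by positivity, ?_⟩, fun l hBl hlB3 ↦ ⟨?_, ?_⟩⟩
  · have h1 := step d.B (by omega) (π / 4) hpen4
    have h0' : (0 : ℝ) < (dhatOBox S C LQ tab d d.B).lo := by exact_mod_cast h0
    have h3 := lt_of_lt_of_le h0' h1
    rcases pos_and_pos_or_neg_and_neg_of_mul_pos h3 with ⟨_, h⟩ | ⟨h, _⟩
    · linarith
    · exact absurd h (not_lt.2 hSr.le)
  · have h1 := step d.B3 (by omega) (π / 4) hpen4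
    have hd0' : ((d.d0N : ℤ) : ℝ) * S ≤ ((dhatOBox S C LQ tab d d.B3).lo : ℝ) * 2 ^ d.wbits := by exact_mod_cast hd0
    have h2 : (0 : ℝ) < 2 ^ d.wbits := by positivity
    rw [div_le_iff₀ h2]
    push_cast at hd0' h1 ⊢
    nlinarith
  · have := (hw (l - d.B) (by omega)).1
    positivity
  · have hpen : (π / 2 - Real.arctan (Real.sqrt d.B / Real.sqrt ((l : ℝ) + 1))) / 2 ≤ π / 4 := by
      have h0 : 0 ≤ Real.arctan (Real.sqrt d.B / Real.sqrt ((l : ℝ) + 1)) := by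
        have hm := Real.arctan_strictMono.monotone (show (0 : ℝ) ≤ Real.sqrt d.B / Real.sqrt ((l : ℝ) + 1) by positivity)
        rwa [Real.arctan_zero] at hm
      linarith
    have h1 := step l (by omega) _ hpen
    have hw' := (hw (l - d.B) (by omega)).2
    rw [show d.B + (l - d.B) = l by omega] at hw'
    have hw'' : ((d.wN.getD (l - d.B) 0 : ℤ) : ℝ) * S ≤ ((dhatOBox S C LQ tab d l).lo : ℝ) * 2 ^ d.wbits := by
      exact_mod_cast hw'
    have h2 : (0 : ℝ) < 2 ^ d.wbits := by positivity
    rw [div_le_iff₀ h2]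
    push_cast at hw'' h1 ⊢
    nlinarith

end TwistedEncl

end Summit.Ventures.WeilGRH
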